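import Summits.CriticalPhenomena.PercolationContinuityZ3.Theorems.Transplant.FKConnectivityAllQTwoSum
import Summits.CriticalPhenomena.PercolationContinuityZ3.Theorems.Transplant.FKConnectivityAllQTwoSumClassDefs
import HarnessLib

/-!
# Connectivity correlation inequalities for `φ_{w,q}`, every `q > 0` — TWO-SUMS, file 6: NEGATIVE ASSOCIATION ON THE CLASS GLUED
# FROM 2-TREES AND `K₄`'s (Wagner's stock of Potts–Rayleigh graphs, kernel)

Support file (`--supports stmt-CriticalPhenomena-4575`), FK sub-lane `prim-bschramm-fk-1` (gen 6) of the post-continuity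
programme; builds on p205010 (kernel theorem, internal audit signed; external expert review pending).  No definitions, no named
facts, no sorries; standard axioms.

* **`FK.edgeNegCorrSupp_of_isTwoTreeK4Glued`** (`0 < q ≤ 1`): every edge set in the class `FK.IsTwoTreeK4Glued` (2-trees and
  `K₄`'s glued along shared pairs, `…TwoSumClassDefs.lean`) carries edge-negatively associated random-cluster measures for ALL
  weight vectors supported in it: `φ_{w,q}(J_e ∩ J_f) ≤ φ_{w,q}(J_e)φ_{w,q}(J_f)`.  Induction: 2-trees (fk-1 g5,
  `edgeNegCorrSupp_of_isTwoTree`), `K₄` (fk-1 g5, `edgeNegCorr_supp_K4` — Sokal's computation, kernel), gluing step = Wagner's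
  two-sum theorem (`edgeNegCorrSupp_parallelConnection`, file 4).  Subsets inherit (`edgeNegCorrSupp_of_subset_twoTreeK4Glued`).
* Consequences for `q ∈ (0,1)` via fk-2's support-restricted hierarchy (`…AllQEdgeLocal.lean`): pairwise positive correlation of
  connection events `pairConnPosUnder_of_isTwoTreeK4Glued` and the hub inequality of Ayyer–Linusson–Ravichandran (13)
  `hubUnder_of_isTwoTreeK4Glued` — UNCONDITIONAL on this class (ALR prove (13) for the arboreal gas on outerplanar graphs and
  conjecture it in general, Conj. 7.1).
* `FK.isTwoTreeK4Glued_K4_K4` — two `K₄`'s sharing an edge are in the class (so the class strictly exceeds series–parallel ∪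
  {≤ 4 vertices}).
Print status: Wagner 2008, §5.3 lists exactly this stock (uniform matroids, `K₄`; duals, minors, two-sums) with `K₄` credited to an
unpublished computation of Sokal; here every step is a kernel theorem with standard axioms.
[cite: Wagner2006, Ex. 5.1, Thm. 5.8(d), §5.3 (pp. 13–15)] [cite: Grimmett2006, §3.9 eq. (3.94) (pp. 63–64)]
[cite: AyyerLinussonRavichandran2025, §7 eq. (13)–(15), Conj. 7.1, Thm. 5.3 (pp. 22–27)]
-/

noncomputable section

namespace Summit.CriticalPhenomena.PercolationContinuityZ3.Theorems

namespace FK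

open MeasureTheory Literature.Probability.LatticeModels Literature.Probability.Percolation
open scoped Classical

variable {V : Type*} [Fintype V]

/-- **Negative association on the class glued from 2-trees and `K₄`'s** (`0 < q ≤ 1`): for every edge set `E` in
`IsTwoTreeK4Glued` and every weight vector `w` supported in `E`, `φ_{w,q}(J_e ∩ J_f) ≤ φ_{w,q}(J_e)·φ_{w,q}(J_f)` for all non-loop
`e` and all `f ≠ e`.  (Wagner 2008, Thm. 5.8(d) + Ex. 5.1 + §5.3, graph case; kernel.) [cite: Wagner2006, Ex. 5.1, Thm. 5.8(d), §5.3 (pp. 13–15)]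
[cite: Grimmett2006, §3.9 eq. (3.94) (pp. 63–64)] -/
theorem edgeNegCorrSupp_of_isTwoTreeK4Glued {q : ℝ} (hq0 : 0 < q) (hq1 : q ≤ 1) {E : Set (Sym2 V)} (h : IsTwoTreeK4Glued E) :
    EdgeNegCorrSupp E q := by
  induction h with
  | twoTree hT => exact edgeNegCorrSupp_of_isTwoTree hq0 hq1 hT
  | k4 hxy hxz hxt hyz hyt hzt => exact edgeNegCorr_supp_K4 hq0 hq1 hxy hxz hxt hyz hyt hzt
  | @glue E₁ E₂ s t _ _ hst hst₁ hst₂ hd hV ih₁ ih₂ =>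
    exact edgeNegCorrSupp_parallelConnection hq0 hq1 hst hst₁ hst₂ hd (V₁ := {z | ∃ e ∈ E₁, z ∈ e})
      (V₂ := {z | ∃ e ∈ E₂, z ∈ e}) (fun e he z hz => ⟨e, he, hz⟩) (fun e he z hz => ⟨e, he, hz⟩)
      (fun z hz => by
        rcases hV z hz.1 hz.2 with rfl | rfl
        · exact Or.inl rfl
        · exact Or.inr rfl)
      ih₁ ih₂

/-- Subsets of members of the class (the series–parallel graphs, everything built from `K₄`'s and series–parallel pieces by
two-sums, …) carry negatively associated `φ_{w,q}`, `0 < q ≤ 1`. [cite: Wagner2006, Thm. 5.8(d), §5.3 (pp. 14–15)] -/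
theorem edgeNegCorrSupp_of_subset_twoTreeK4Glued {q : ℝ} (hq0 : 0 < q) (hq1 : q ≤ 1) {S E : Set (Sym2 V)}
    (h : IsTwoTreeK4Glued E) (hSE : S ⊆ E) : EdgeNegCorrSupp S q :=
  EdgeNegCorrSupp.mono hSE (edgeNegCorrSupp_of_isTwoTreeK4Glued hq0 hq1 h)

/-- **Pairwise positive correlation of connection events on the class, every `q ∈ (0,1)`** — UNCONDITIONAL: if `w` is supported
in `E ∈ IsTwoTreeK4Glued` and `xy, uv ∈ E`, then `φ_{w,q}(x ↔ y)·φ_{w,q}(u ↔ v) ≤ φ_{w,q}(x ↔ y, u ↔ v)`.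
[cite: AyyerLinussonRavichandran2025, §7 eq. (13)–(15), (19) (pp. 22–27)] [cite: Wagner2006, Thm. 5.8(d), §5.3] -/
theorem pairConnPosUnder_of_isTwoTreeK4Glued {q : ℝ} (hq0 : 0 < q) (hq1 : q < 1) {E : Set (Sym2 V)}
    (h : IsTwoTreeK4Glued E) {x y u v : V} (hxy : s(x, y) ∈ E) (huv : s(u, v) ∈ E) (w : Sym2 V → unitInterval)
    (hw : ∀ e, ((w e : unitInterval) : ℝ) ≠ 0 → e ∈ E) : PairConnPosUnder (rcMeasureW w q ∅) x y u v :=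
  pairConnPosUnder_of_edgeNegCorr_on hq0 hq1 E (edgeNegCorrSupp_of_isTwoTreeK4Glued hq0 hq1.le h) x y u v hxy huv w hw

/-- **The hub inequality (Ayyer–Linusson–Ravichandran (13)) on the class, every `q ∈ (0,1)`** — UNCONDITIONAL: for `w` supported
in `E ∈ IsTwoTreeK4Glued` with `oa, ba ∈ E`, `φ_{w,q}(o ↔ a)·φ_{w,q}(b ↔ a) ≤ φ_{w,q}(o ↔ a ↔ b)`.
[cite: AyyerLinussonRavichandran2025, §7 eq. (13), Conj. 7.1, Thm. 5.3 (p. 22)] [cite: Wagner2006, Thm. 5.8(d), §5.3] -/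
theorem hubUnder_of_isTwoTreeK4Glued {q : ℝ} (hq0 : 0 < q) (hq1 : q < 1) {E : Set (Sym2 V)} (h : IsTwoTreeK4Glued E)
    {o a b : V} (hoa : s(o, a) ∈ E) (hba : s(b, a) ∈ E) (w : Sym2 V → unitInterval)
    (hw : ∀ e, ((w e : unitInterval) : ℝ) ≠ 0 → e ∈ E) : HubUnder (rcMeasureW w q ∅) o a b :=
  hubUnder_of_edgeNegCorr_on hq0 hq1 E (edgeNegCorrSupp_of_isTwoTreeK4Glued hq0 hq1.le h) o a b hoa hba w hw

/-! ### Members beyond series–parallel: two `K₄`'s sharing an edge -/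

omit [Fintype V] in
/-- **Two `K₄`'s sharing the pair `st` are in the class.** [cite: Wagner2006, §5.3 (p. 15)] -/
theorem isTwoTreeK4Glued_K4_K4 {x y s t u v : V} (hxy : x ≠ y) (hxs : x ≠ s) (hxt : x ≠ t) (hys : y ≠ s) (hyt : y ≠ t)
    (hst : s ≠ t) (huv : u ≠ v) (hus : u ≠ s) (hut : u ≠ t) (hvs : v ≠ s) (hvt : v ≠ t) (hxu : x ≠ u) (hxv : x ≠ v)
    (hyu : y ≠ u) (hyv : y ≠ v) :
    IsTwoTreeK4Glued (({s(x, y), s(x, s), s(x, t), s(y, s), s(y, t), s(s, t)} : Set (Sym2 V)) ∪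
      {s(u, v), s(u, s), s(u, t), s(v, s), s(v, t), s(s, t)}) := by
  refine IsTwoTreeK4Glued.glue (IsTwoTreeK4Glued.k4 hxy hxs hxt hys hyt hst) (IsTwoTreeK4Glued.k4 huv hus hut hvs hvt hst)
    hst (by simp) (by simp) ?_ ?_
  · rw [Set.disjoint_left]
    rintro g ⟨hg₁, hg⟩ hg₂
    simp only [Set.mem_insert_iff, Set.mem_singleton_iff] at hg₁ hg₂ hg
    rcases hg₁ with rfl | rfl | rfl | rfl | rfl | rfl <;>
      rcases hg₂ with h | h | h | h | h | h <;>
      simp_all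
  · rintro z ⟨e₁, he₁, hz₁⟩ ⟨e₂, he₂, hz₂⟩
    simp only [Set.mem_insert_iff, Set.mem_singleton_iff] at he₁ he₂
    rcases he₁ with rfl | rfl | rfl | rfl | rfl | rfl <;>
      rcases he₂ with rfl | rfl | rfl | rfl | rfl | rfl <;>
      (rw [Sym2.mem_iff] at hz₁ hz₂; rcases hz₁ with rfl | rfl <;> rcases hz₂ with h | h <;> simp_all)

/-- Sanity: the two-`K₄` theorem of file 4 is an instance of the class theorem. [cite: Wagner2006, Thm. 5.8(d), §5.3] -/
example {q : ℝ} (hq0 : 0 < q) (hq1 : q ≤ 1) {x y s t u v : V} (hxy : x ≠ y) (hxs : x ≠ s) (hxt : x ≠ t) (hys : y ≠ s)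
    (hyt : y ≠ t) (hst : s ≠ t) (huv : u ≠ v) (hus : u ≠ s) (hut : u ≠ t) (hvs : v ≠ s) (hvt : v ≠ t) (hxu : x ≠ u)
    (hxv : x ≠ v) (hyu : y ≠ u) (hyv : y ≠ v) :
    EdgeNegCorrSupp (({s(x, y), s(x, s), s(x, t), s(y, s), s(y, t), s(s, t)} : Set (Sym2 V)) ∪
      {s(u, v), s(u, s), s(u, t), s(v, s), s(v, t), s(s, t)}) q :=
  edgeNegCorrSupp_of_isTwoTreeK4Glued hq0 hq1
    (isTwoTreeK4Glued_K4_K4 hxy hxs hxt hys hyt hst huv hus hut hvs hvt hxu hxv hyu hyv)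

end FK

end Summit.CriticalPhenomena.PercolationContinuityZ3.Theorems

end
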